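import Summits.QuantumFields.GaugeBoot.TiltedBoxOddAxisRPNegative
import Literature.MathematicalPhysics.QuantumLattice.GaugeGroups
import HarnessLib

/-!
# The odd-side axis-RP negative for the venture's gauge groups `SU(N)`, `U(N)`: the defining representations have scalar commutant (gauge-boot, L3 negative supplement)

HONEST FRAMING (cell `pub-gaugeboot`, page 1 of every file): the venture produces certified bounds
on lattice expectations at stated coupling, gauge group, dimension and torus size; NOT a mass gap,
NOT a continuum limit, NOT a string tension; NOT Yang–Mills-summit-bearing (barriers
`FixedCouplingUltralocality`, `PerturbativeInvisibility`).

`TiltedBoxOddAxisRPNegative.not_tiltedBox_axisRP_odd` assumes that the representation has scalar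
commutant (`TwistedSlab.HasScalarCommutant`, the conclusion of Schur's lemma). This file discharges it
for the defining representations of the cell's gauge groups by elementary linear algebra (no
representation theory): a matrix commuting with all DIAGONAL PHASE matrices
`D_{ab} = diag(…, i_a, …, -i_b, …, 1, …) ∈ SU(N)` is diagonal, and a diagonal matrix commuting with the
SIGNED TRANSPOSITIONS `R_{ab} = P_{(ab)} · diag(…, -1_a, …) ∈ SU(N)` has equal entries:

* `phaseDiag`, `signedSwap` and their membership in `SU(N)`;
* **`hasScalarCommutant_fundamentalRep`** (`SU(N)`, every `N`) and **`hasScalarCommutant_unitaryFundamentalRep`**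
  (`U(N)`, every `N`);
* the corollaries **`not_tiltedBox_axisRP_odd_suN`** (`N ≥ 2`) and **`not_tiltedBox_axisRP_odd_uN`**
  (`N ≥ 1`): on the square tilted box of odd side `2P + 1 ≥ 3`, `d ≥ 3`, `L ≥ 2`, closed-half axis RP
  along `i` FAILS for `SU(N)` resp. `U(N)` lattice gauge theory at every `β > 0`.

Everything is `[folklore]`.

References: T. Bröcker, T. tom Dieck, GTM 98 (1985), II §1; J. Fröhlich, R. Israel, E. H. Lieb,
B. Simon, J. Stat. Phys. 22 (1980) 297, §3.
-/

noncomputable section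

open MeasureTheory Complex Matrix
open scoped ComplexOrder ComplexConjugate
open Literature.MathematicalPhysics.QuantumLattice

namespace Summit.QuantumFields.GaugeBoot

namespace TiltedRP

/-! ## Two families of special unitary matrices -/

section Matrices

variable {N : ℕ}

/-- The diagonal phase matrix `D_{ab}`: `i` at `a`, `-i` at `b`, `1` elsewhere. [folklore] -/
def phaseDiag (a b : Fin N) : Matrix (Fin N) (Fin N) ℂ :=
  diagonal (Function.update (Function.update (fun _ => (1 : ℂ)) b (-I)) a I)

/-- The entries of the phase vector have modulus one. [folklore] -/
theorem phaseDiag_entry_mul_conj (a b x : Fin N) :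
    Function.update (Function.update (fun _ => (1 : ℂ)) b (-I)) a I x *
      conj (Function.update (Function.update (fun _ => (1 : ℂ)) b (-I)) a I x) = 1 := by
  by_cases hxa : x = a
  · subst hxa; simp
  · rw [Function.update_of_ne hxa]
    by_cases hxb : x = b
    · subst hxb; simp
    · rw [Function.update_of_ne hxb]; simp

/-- `D_{ab} ∈ SU(N)` for `a ≠ b`. [folklore] -/
theorem phaseDiag_mem (a b : Fin N) (hab : a ≠ b) :
    phaseDiag a b ∈ Matrix.specialUnitaryGroup (Fin N) ℂ := by
  rw [Matrix.mem_specialUnitaryGroup_iff, Matrix.mem_unitaryGroup_iff]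
  refine ⟨?_, ?_⟩
  · rw [phaseDiag, star_eq_conjTranspose, diagonal_conjTranspose, diagonal_mul_diagonal, ← diagonal_one]
    congr 1
    funext x
    exact phaseDiag_entry_mul_conj a b x
  · rw [phaseDiag, det_diagonal, Finset.prod_update_of_mem (Finset.mem_univ a),
      Finset.prod_update_of_mem (by simp [Ne.symm hab] : b ∈ Finset.univ \ {a})]
    simp

/-- The signed transposition `R_{ab} = P_{(ab)} · diag(-1 at a)`. [folklore] -/
def signedSwap (a b : Fin N) : Matrix (Fin N) (Fin N) ℂ :=
  (Equiv.swap a b).permMatrix ℂ * diagonal (Function.update (fun _ => (1 : ℂ)) a (-1))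

/-- A permutation matrix is unitary. [folklore] -/
theorem permMatrix_mem_unitaryGroup (σ : Equiv.Perm (Fin N)) :
    σ.permMatrix ℂ ∈ Matrix.unitaryGroup (Fin N) ℂ := by
  rw [Matrix.mem_unitaryGroup_iff, star_eq_conjTranspose, conjTranspose_permMatrix, Equiv.Perm.inv_def,
    Equiv.Perm.permMatrix, Equiv.Perm.permMatrix, ← PEquiv.toMatrix_trans, ← Equiv.toPEquiv_trans,
    Equiv.self_trans_symm, Equiv.toPEquiv_refl, PEquiv.toMatrix_refl]

/-- `diag(-1 at a)` is unitary. [folklore] -/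
theorem signDiag_mem_unitaryGroup (a : Fin N) :
    diagonal (Function.update (fun _ => (1 : ℂ)) a (-1)) ∈ Matrix.unitaryGroup (Fin N) ℂ := by
  rw [Matrix.mem_unitaryGroup_iff, star_eq_conjTranspose, diagonal_conjTranspose, diagonal_mul_diagonal,
    ← diagonal_one]
  congr 1
  funext x
  by_cases hxa : x = a
  · subst hxa; simp
  · simp [Function.update_of_ne hxa]

/-- `R_{ab} ∈ SU(N)` for `a ≠ b` (`det P_{(ab)} = -1`, `det diag(-1 at a) = -1`). [folklore] -/
theorem signedSwap_mem (a b : Fin N) (hab : a ≠ b) :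
    signedSwap a b ∈ Matrix.specialUnitaryGroup (Fin N) ℂ := by
  rw [Matrix.mem_specialUnitaryGroup_iff]
  refine ⟨Submonoid.mul_mem _ (permMatrix_mem_unitaryGroup _) (signDiag_mem_unitaryGroup a), ?_⟩
  rw [signedSwap, det_mul, det_permutation, Equiv.Perm.sign_swap hab, det_diagonal,
    Finset.prod_update_of_mem (Finset.mem_univ a)]
  simp

/-- The entry `(b, a)` of `R_{ab}` is `-1`. [folklore] -/
theorem signedSwap_apply_right_left (a b : Fin N) : signedSwap a b b a = -1 := by
  rw [signedSwap, Equiv.Perm.permMatrix, PEquiv.toMatrix_toPEquiv_mul, submatrix_apply, id,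
    Equiv.swap_apply_right, diagonal_apply_eq, Function.update_self]

/-! ## Scalar commutant -/

/-- **A matrix commuting with every `D_{ab}` and every `R_{ab}` (`a ≠ b`) is a scalar.** [folklore] -/
theorem exists_eq_smul_one_of_commute (M : Matrix (Fin N) (Fin N) ℂ)
    (hD : ∀ a b, a ≠ b → phaseDiag a b * M = M * phaseDiag a b)
    (hR : ∀ a b, a ≠ b → signedSwap a b * M = M * signedSwap a b) :
    ∃ c : ℂ, M = c • (1 : Matrix (Fin N) (Fin N) ℂ) := by
  -- off-diagonal entries vanish
  have hoff : ∀ x y, x ≠ y → M x y = 0 := by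
    intro x y hxy
    have h := congrFun (congrFun (hD x y hxy) x) y
    rw [phaseDiag, diagonal_mul, mul_diagonal, Function.update_self, Function.update_of_ne (Ne.symm hxy),
      Function.update_self] at h
    -- `I * M x y = M x y * (-I)`
    have h2 : (2 * I) * M x y = 0 := by linear_combination h
    rcases mul_eq_zero.1 h2 with h3 | h3
    · exact absurd h3 (mul_ne_zero two_ne_zero I_ne_zero)
    · exact h3
  -- diagonal entries agree
  have hdiag : ∀ a b, a ≠ b → M a a = M b b := by
    intro a b hab
    have hM : M = diagonal fun x => M x x := by
      ext x y
      by_cases hxy : x = y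
      · subst hxy; rw [diagonal_apply_eq]
      · rw [diagonal_apply_ne _ hxy, hoff x y hxy]
    have h := congrFun (congrFun (hR a b hab) b) a
    rw [hM, mul_diagonal, diagonal_mul, signedSwap_apply_right_left] at h
    -- `-1 * M a a = M b b * (-1)`
    linear_combination -h
  -- conclude
  rcases Nat.eq_zero_or_pos N with hN | hN
  · subst hN
    exact ⟨0, by ext x; exact Fin.elim0 x⟩
  · refine ⟨M ⟨0, hN⟩ ⟨0, hN⟩, ?_⟩
    ext x y
    by_cases hxy : x = y
    · subst hxy
      rw [Matrix.smul_apply, one_apply_eq, smul_eq_mul, mul_one]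
      by_cases hx0 : x = ⟨0, hN⟩
      · rw [hx0]
      · exact hdiag x _ hx0
    · rw [hoff x y hxy, Matrix.smul_apply, one_apply_ne hxy, smul_zero]

/-- **The defining representation of `SU(N)` has scalar commutant** (every `N`). [folklore] -/
theorem hasScalarCommutant_fundamentalRep : TwistedSlab.HasScalarCommutant (fundamentalRep (Fin N)) := by
  intro M hM
  refine exists_eq_smul_one_of_commute M (fun a b hab => ?_) (fun a b hab => ?_)
  · exact hM ⟨phaseDiag a b, phaseDiag_mem a b hab⟩
  · exact hM ⟨signedSwap a b, signedSwap_mem a b hab⟩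

/-- **The defining representation of `U(N)` has scalar commutant** (every `N`). [folklore] -/
theorem hasScalarCommutant_unitaryFundamentalRep :
    TwistedSlab.HasScalarCommutant (unitaryFundamentalRep (Fin N) ℂ) := by
  intro M hM
  refine exists_eq_smul_one_of_commute M (fun a b hab => ?_) (fun a b hab => ?_)
  · exact hM ⟨phaseDiag a b, Matrix.specialUnitaryGroup_le_unitaryGroup (phaseDiag_mem a b hab)⟩
  · exact hM ⟨signedSwap a b, Matrix.specialUnitaryGroup_le_unitaryGroup (signedSwap_mem a b hab)⟩

/-- `SU(N)` is non-trivial in its defining representation for `N ≥ 2`. [folklore] -/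
theorem exists_fundamentalRep_ne_one (hN : 2 ≤ N) :
    ∃ g : Matrix.specialUnitaryGroup (Fin N) ℂ, fundamentalRep (Fin N) g ≠ 1 := by
  refine ⟨⟨phaseDiag ⟨0, by omega⟩ ⟨1, by omega⟩, phaseDiag_mem _ _ (by simp [Fin.ext_iff])⟩, fun h => ?_⟩
  have h1 := congrFun (congrFun h ⟨0, by omega⟩) ⟨0, by omega⟩
  rw [fundamentalRep_apply] at h1
  simp only [phaseDiag, diagonal_apply_eq, Function.update_self, one_apply_eq] at h1
  exact I_ne_one h1
where
  /-- `i ≠ 1`. [folklore] -/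
  I_ne_one : (I : ℂ) ≠ 1 := fun h => by have := congrArg Complex.im h; simp at this

/-- `U(N)` is non-trivial in its defining representation for `N ≥ 1`. [folklore] -/
theorem exists_unitaryFundamentalRep_ne_one (hN : 1 ≤ N) :
    ∃ g : Matrix.unitaryGroup (Fin N) ℂ, unitaryFundamentalRep (Fin N) ℂ g ≠ 1 := by
  refine ⟨⟨diagonal (Function.update (fun _ => (1 : ℂ)) ⟨0, by omega⟩ (-1)), signDiag_mem_unitaryGroup _⟩,
    fun h => ?_⟩
  have h1 := congrFun (congrFun h ⟨0, by omega⟩) ⟨0, by omega⟩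
  rw [unitaryFundamentalRep_apply] at h1
  simp only [diagonal_apply_eq, Function.update_self, one_apply_eq] at h1
  norm_num at h1

end Matrices

/-! ## The negatives for `SU(N)` and `U(N)` -/

section Groups

variable {d : ℕ} {i j k : Fin d} {L P N : ℕ} [NeZero L] [NeZero P]

/-- **Axis RP fails on the odd square tilted box for `SU(N)` lattice Yang–Mills**: box
`ℤ^d/Γ(2P+1, 2P+1, L)`, `P ≥ 1`, `L ≥ 2`, `k ∉ {i, j}` (`d ≥ 3`), fundamental representation,
`N ≥ 2`, every `β > 0`. [folklore] -/
theorem not_tiltedBox_axisRP_odd_suN (hij : i ≠ j) (hki : k ≠ i) (hkj : k ≠ j) (hL : 2 ≤ L) (hN : 2 ≤ N)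
    {β : ℝ} (hβ : 0 < β) :
    ¬ ∀ F : Config (TiltedSite d i j (2 * P + 1) (2 * P + 1) L) d (Matrix.specialUnitaryGroup (Fin N) ℂ) → ℂ,
        Measurable F → (∃ C : ℝ, ∀ U, ‖F U‖ ≤ C) →
        IsHalfObservable (tiltedUnit d i j (2 * P + 1) (2 * P + 1) L) (2 * P + 1) (axisHeight2 d L (2 * P + 1)) F →
        0 ≤ ∫ U, conj (F (configReflect (tiltedUnit d i j (2 * P + 1) (2 * P + 1) L) i
          (tiltedAxisFlip d L (2 * P + 1) hij) U)) * F U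
          ∂(gibbs (fundamentalRep (Fin N)) (tiltedUnit d i j (2 * P + 1) (2 * P + 1) L) β) := by
  haveI : SecondCountableTopology (Matrix (Fin N) (Fin N) ℂ) :=
    inferInstanceAs (SecondCountableTopology (Fin N → Fin N → ℂ))
  haveI : SecondCountableTopology (Matrix.specialUnitaryGroup (Fin N) ℂ) :=
    Topology.IsEmbedding.subtypeVal.secondCountableTopology
  exact not_tiltedBox_axisRP_odd (fundamentalRep (Fin N)) hij hki hkj hL (continuous_fundamentalRep (Fin N))
    hasScalarCommutant_fundamentalRep (by omega) (exists_fundamentalRep_ne_one hN) hβ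

/-- **Axis RP fails on the odd square tilted box for `U(N)` lattice gauge theory** (`N ≥ 1`, every
`β > 0`; same box hypotheses). [folklore] -/
theorem not_tiltedBox_axisRP_odd_uN (hij : i ≠ j) (hki : k ≠ i) (hkj : k ≠ j) (hL : 2 ≤ L) (hN : 1 ≤ N)
    {β : ℝ} (hβ : 0 < β) :
    ¬ ∀ F : Config (TiltedSite d i j (2 * P + 1) (2 * P + 1) L) d (Matrix.unitaryGroup (Fin N) ℂ) → ℂ,
        Measurable F → (∃ C : ℝ, ∀ U, ‖F U‖ ≤ C) →
        IsHalfObservable (tiltedUnit d i j (2 * P + 1) (2 * P + 1) L) (2 * P + 1) (axisHeight2 d L (2 * P + 1)) F →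
        0 ≤ ∫ U, conj (F (configReflect (tiltedUnit d i j (2 * P + 1) (2 * P + 1) L) i
          (tiltedAxisFlip d L (2 * P + 1) hij) U)) * F U
          ∂(gibbs (unitaryFundamentalRep (Fin N) ℂ) (tiltedUnit d i j (2 * P + 1) (2 * P + 1) L) β) := by
  haveI : SecondCountableTopology (Matrix (Fin N) (Fin N) ℂ) :=
    inferInstanceAs (SecondCountableTopology (Fin N → Fin N → ℂ))
  haveI : SecondCountableTopology (Matrix.unitaryGroup (Fin N) ℂ) :=
    Topology.IsEmbedding.subtypeVal.secondCountableTopology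
  exact not_tiltedBox_axisRP_odd (unitaryFundamentalRep (Fin N) ℂ) hij hki hkj hL
    (continuous_unitaryFundamentalRep (n := Fin N) (𝕜 := ℂ)) hasScalarCommutant_unitaryFundamentalRep hN
    (exists_unitaryFundamentalRep_ne_one hN) hβ

end Groups

end TiltedRP

end Summit.QuantumFields.GaugeBoot

end
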